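import Summits.ResolutionOfSingularities.ResolutionOfSingularities.Theorems.EquisingularLiftEquisingularLiftNatModelStep
import Summits.ResolutionOfSingularities.ResolutionOfSingularities.Theorems.EquisingularLiftEquisingularLiftNatPointStep
import Summits.ResolutionOfSingularities.ResolutionOfSingularities.Theorems.EquisingularLiftEquisingularLiftGoodAtOfRegularFibre
import Summits.ResolutionOfSingularities.ResolutionOfSingularities.Theorems.EquisingularLiftEquisingularLiftSectionComapPoint
import Summits.ResolutionOfSingularities.ResolutionOfSingularities.Theorems.EquisingularLiftEquisingularLiftCentreBlowupSmooth
import HarnessLib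

/-!
# [OURS · L1 W4.5(b) · EL♮ T-ISO-0⁺] THE MODEL POINT STEP: a downstairs point blow-up at a REGULAR ambient point is the special
# fibre of the blow-up of a Hensel SECTION (kit K3 of res-D-pv-029's T-ISO-0⁺, res-L1-w45b-plan-1 ORDERS AMENDMENT 2 (c) 2026-08-27)

Crux `EquisingularLiftNat` = stmt-ResolutionOfSingularities-20038 (route EquisingularLift), line `sections`; helper file
`--supports … --as helper`. HONEST FRAMING: OURS (cell res-hironaka, slot W4.5(b)); NOT a statement of any manuscript; AI-written,
weaker than expert review. No `sorry`; standard axioms.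

THE STEP (`modelPointStep`). Over a complete DVR `O` with algebraically closed residue field and a surjection `θ : O ↠ k` onto a field:
an upstairs stage `(X', σ', S')` (any stage predicate `Ch` closed under horizontal E1 steps) with `X'` integral, regular, locally
Noetherian, `σ' ≫ q` proper and dominant; a downstairs stage `(F, T)` (`F` integral) in a MODEL SQUARE `IsPullback j t (σ' ≫ q) (Spec θ)`
with `j '' T = S'`; a CLOSED point `x ∈ T` at which the AMBIENT `F` is REGULAR, which is not all of `T` and whose image `σ' (j x)` is
not the generic point of `Y`; a downstairs blow-up `υ : F₂ → F` of the reduced point `x`. OUTPUT: a smooth neighbourhood `U ∋ j x`,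
a section `s` of `σ' ≫ q` through `j x`, a blow-up `τ : X'' → X'` along `ker s` with the new `Ch` stage, `X''` integral regular
locally Noetherian and dominant over `Spec O`, and the NEW MODEL SQUARE `j₂ : F₂ → X''` with `j₂ ≫ τ = υ ≫ j` and matching
strict-transform sets — i.e. `modelStep` (K2, p509016) fed with `C = ker s`, `D = 𝔪_x`, `ker s · 𝒪_F = 𝔪_x`
(`ker_section_comap_eq_vanishingIdeal`).

GOOD REDUCTION IS READ THROUGH THE MODEL (`goodAt_of_model`): `X'` regular at `j x`, the germ of a uniformizer non-zero (`X'`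
integral and dominant over `O`), and the special fibre `X' ×_O κ ≅ F` regular over `j x` because `F` is regular at `x`
(`goodAt_of_isRegularLocalRing_fibre` through the `κ ≅ k` adapter `isPullback_residue_of_model`).

References: Q. Liu, *Algebraic Geometry and Arithmetic Curves* (2002), §8.1, Thm. 8.1.19; The Stacks Project, Tags 0805, 056P.
-/

set_option linter.dupNamespace false -- mandated namespace `Summit.<Summit>.<Problem>` of this single-conjunct summit
set_option linter.overlappingInstances false -- signatures carry `[IsDomain O] [IsDiscreteValuationRing O]`

noncomputable section

open CategoryTheory CategoryTheory.Limits AlgebraicGeometry TopologicalSpace Topology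
open Literature.AlgebraicGeometry.Resolution
open AlgebraicGeometry.Scheme.IdealSheafData
open Summit.ResolutionOfSingularities.ResolutionOfSingularities.Theses.EquisingularLift.Split
open Summit.ResolutionOfSingularities.ResolutionOfSingularities.Cruxes.EquisingularLift.StrataSplit

namespace Summit.ResolutionOfSingularities.ResolutionOfSingularities.Cruxes.EquisingularLiftNat.Sections

universe u

/-! ## The `κ ≅ k` adapter -/

/-- A surjection from a local ring onto a field is a local homomorphism. [folklore] -/
theorem isLocalHom_of_surjective_field {O k : Type u} [CommRing O] [IsLocalRing O] [Field k] (θ : O →+* k)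
    (hθ : Function.Surjective θ) : IsLocalHom θ := by
  refine ⟨fun a ha => ?_⟩
  by_contra hna
  have hker : RingHom.ker θ = IsLocalRing.maximalIdeal O :=
    IsLocalRing.eq_maximalIdeal (RingHom.ker_isMaximal_of_surjective θ hθ)
  have hmem : a ∈ RingHom.ker θ := by
    rw [hker]
    exact (IsLocalRing.mem_maximalIdeal a).mpr hna
  exact (isUnit_iff_ne_zero.mp ha) ((RingHom.mem_ker).mp hmem)

/-- For a surjection `θ : O ↠ k` from a local ring onto a field, `Spec θ` factors as an ISOMORPHISM `Spec k ≅ Spec κ` followed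
by `Spec (residue O)`. [folklore] -/
theorem exists_iso_specMap_residue {O k : Type u} [CommRing O] [IsLocalRing O] [Field k] (θ : O →+* k)
    (hθ : Function.Surjective θ) :
    ∃ e : Spec (.of k) ≅ Spec (.of (IsLocalRing.ResidueField O)),
      e.hom ≫ Spec.map (CommRingCat.ofHom (IsLocalRing.residue O)) = Spec.map (CommRingCat.ofHom θ) := by
  haveI := isLocalHom_of_surjective_field θ hθ
  have hbij : Function.Bijective (IsLocalRing.ResidueField.lift θ) := by
    refine ⟨(IsLocalRing.ResidueField.lift θ).injective, fun b => ?_⟩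
    obtain ⟨a, rfl⟩ := hθ b
    exact ⟨IsLocalRing.residue O a, IsLocalRing.ResidueField.lift_residue_apply θ a⟩
  let ē : IsLocalRing.ResidueField O ≃+* k := RingEquiv.ofBijective _ hbij
  refine ⟨Scheme.Spec.mapIso (ē.toCommRingCatIso).op, ?_⟩
  change Spec.map (CommRingCat.ofHom ē.toRingHom) ≫ _ = _
  rw [← Spec.map_comp, ← CommRingCat.ofHom_comp]
  exact congrArg (fun f : O →+* k => Spec.map (CommRingCat.ofHom f)) (IsLocalRing.ResidueField.lift_comp_residue θ)

/-- **The model is the special fibre.** A model square over `Spec θ` is a cartesian square over `Spec (residue O)` after the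
isomorphism `Spec k ≅ Spec κ`. [folklore] -/
theorem isPullback_residue_of_model {O k : Type} [CommRing O] [IsLocalRing O] [Field k] (θ : O →+* k)
    (hθ : Function.Surjective θ) {X' F : Scheme.{0}} (r' : X' ⟶ Spec (.of O)) (j : F ⟶ X') (t : F ⟶ Spec (.of k))
    (hsq : IsPullback j t r' (Spec.map (CommRingCat.ofHom θ))) :
    ∃ t' : F ⟶ Spec (.of (IsLocalRing.ResidueField O)),
      IsPullback j t' r' (Spec.map (CommRingCat.ofHom (IsLocalRing.residue O))) := by
  obtain ⟨e, he⟩ := exists_iso_specMap_residue θ hθ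
  refine ⟨t ≫ e.hom, hsq.of_iso (Iso.refl _) (Iso.refl _) e (Iso.refl _) (by simp) (by simp) (by simp) ?_⟩
  rw [Iso.refl_hom, Category.comp_id, he]

/-- **Good reduction read through the model.** In a model square over a DVR, if the upstairs ambient `X'` is integral,
regular and dominant (proper) over `Spec O`, and the downstairs ambient `F` is regular at `x`, then `X' → Spec O` has good
reduction at `j x`. [cite: Matsumura1987, Thm. 14.2] -/
theorem goodAt_of_model (O : Type) [CommRing O] [IsDomain O] [IsDiscreteValuationRing O] (k : Type) [Field k]
    (θ : O →+* k) (hθ : Function.Surjective θ) (X' F : Scheme.{0}) [IsIntegral X'] (r' : X' ⟶ Spec (.of O))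
    [IsDominant r'] [QuasiCompact r'] (hreg : Scheme.IsRegular X') (j : F ⟶ X') (t : F ⟶ Spec (.of k))
    (hsq : IsPullback j t r' (Spec.map (CommRingCat.ofHom θ))) (x : F) (hx : IsRegularLocalRing (F.presheaf.stalk x)) :
    GoodAt r' (j x) := by
  -- `j` is a closed immersion (base change of `Spec θ`)
  haveI : IsClosedImmersion (Spec.map (CommRingCat.ofHom θ)) := IsClosedImmersion.spec_of_surjective _ hθ
  haveI hjci : IsClosedImmersion j := MorphismProperty.IsStableUnderBaseChange.of_isPullback hsq.flip inferInstance
  refine goodAt_of_isRegularLocalRing_fibre O X' r' (j x) (hreg _) (fun ϖ hϖ h0 => ?_) (fun z hz => ?_)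
  · -- the germ of `ϖ` is non-zero: `r'^* ϖ ≠ 0` (dominant onto the reduced `Spec O`) and germs are injective on the integral `X'`
    haveI : IsSchemeTheoreticallyDominant r' := IsSchemeTheoreticallyDominant.of_isDominant r'
    have h1 : r'.appTop ((Scheme.ΓSpecIso (.of O)).inv ϖ) ≠ 0 := by
      intro h
      have h2 : (Scheme.ΓSpecIso (.of O)).inv ϖ = 0 := r'.app_injective ⊤ (h.trans (map_zero _).symm)
      have h3 : ϖ = 0 := by
        have := congrArg (Scheme.ΓSpecIso (.of O)).hom h2
        simpa using this
      exact hϖ.ne_zero h3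
    apply h1
    have hinj := germ_injective_of_isIntegral (X := X') (U := ⊤) (j x) (Set.mem_univ _)
    exact hinj (h0.trans (map_zero _).symm)
  · -- the special fibre `X' ×_O κ ≅ F` is regular at the point over `j x`
    obtain ⟨t', hsq'⟩ := isPullback_residue_of_model θ hθ r' j t hsq
    set e := hsq'.isoPullback with he
    have hefst : e.hom ≫ pullback.fst r' (Spec.map (CommRingCat.ofHom (IsLocalRing.residue O))) = j :=
      hsq'.isoPullback_hom_fst
    obtain ⟨y, rfl⟩ := e.hom.homeomorph.surjective z
    have hy : j y = j x :=
      calc j y = (e.hom ≫ pullback.fst r' (Spec.map (CommRingCat.ofHom (IsLocalRing.residue O)))) y := by rw [hefst]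
        _ = pullback.fst r' (Spec.map (CommRingCat.ofHom (IsLocalRing.residue O))) (e.hom y) := Scheme.Hom.comp_apply _ _ _
        _ = j x := hz
    have hyx : y = x := hjci.isClosedEmbedding.injective hy
    subst hyx
    exact (isRegularLocalRing_stalk_iff_of_iso e y).mpr hx

/-! ## The model point step -/

/-- **THE MODEL POINT STEP of T-ISO-0⁺** (see the module docstring). [cite: Liu2002, §8.1 and Thm. 8.1.19] -/
theorem modelPointStep (O : Type) [CommRing O] [IsDomain O] [IsDiscreteValuationRing O]
    [IsAdicComplete (IsLocalRing.maximalIdeal O) O] [IsAlgClosed (IsLocalRing.ResidueField O)]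
    (k : Type) [Field k] (θ : O →+* k) (hθ : Function.Surjective θ)
    (P : Scheme.{0}) (q : P ⟶ Spec (.of O)) (Y : Set P) (hY : Y ⊆ q ⁻¹' {IsLocalRing.closedPoint O})
    (Ch : ∀ X' : Scheme.{0}, (X' ⟶ P) → Set X' → Prop)
    (hStep : ∀ (X' X'' : Scheme.{0}) (σ' : X' ⟶ P) (S' : Set X') (C : X'.IdealSheafData) (τ : X'' ⟶ X'),
      Ch X' σ' S' → IsBlowup τ C → Scheme.IsRegular C.subscheme → Flat (C.subschemeι ≫ σ' ≫ q) →
      σ' '' (C.support : Set X') ⊆ {x : P | ¬ IsGenericPoint x Y} →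
      (C.support : Set X') ∩ (σ' ≫ q) ⁻¹' {IsLocalRing.closedPoint O} ⊆ S' →
      Ch X'' (τ ≫ σ') (closure (τ ⁻¹' (S' \ (C.support : Set X')))))
    -- the upstairs stage
    (X' : Scheme.{0}) (σ' : X' ⟶ P) (S' : Set X') (hCh : Ch X' σ' S')
    [IsIntegral X'] [IsLocallyNoetherian X'] (hreg : Scheme.IsRegular X')
    (hproper : IsProper (σ' ≫ q)) (hdom : IsDominant (σ' ≫ q))
    -- the downstairs stage and the model square
    (F : Scheme.{0}) [IsIntegral F] (j : F ⟶ X') (t : F ⟶ Spec (.of k))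
    (hsq : IsPullback j t (σ' ≫ q) (Spec.map (CommRingCat.ofHom θ)))
    (T : Set F) (hTS : j '' T = S')
    -- the point
    (x : F) (hxcl : IsClosed ({x} : Set F)) (hxreg : IsRegularLocalRing (F.presheaf.stalk x)) (hxT : x ∈ T)
    (hTx : ¬ T ⊆ {x}) (hw : ¬ IsGenericPoint (σ' (j x)) Y)
    -- the downstairs blow-up
    (F₂ : Scheme.{0}) (υ : F₂ ⟶ F) (hυ : IsBlowup υ (vanishingIdeal ⟨{x}, hxcl⟩)) :
    ∃ (U : X'.Opens) (s : Spec (.of O) ⟶ X') (X'' : Scheme.{0}) (τ : X'' ⟶ X')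
      (j₂ : F₂ ⟶ X'') (t₂ : F₂ ⟶ Spec (.of k)),
      Smooth (U.ι ≫ σ' ≫ q) ∧ s ≫ σ' ≫ q = 𝟙 _ ∧ s (IsLocalRing.closedPoint O) = j x ∧
      s (IsLocalRing.closedPoint O) ∈ U ∧ IsBlowup τ s.ker ∧
      Ch X'' (τ ≫ σ') (closure (τ ⁻¹' (S' \ (s.ker.support : Set X')))) ∧
      Scheme.IsRegular X'' ∧ IsLocallyNoetherian X'' ∧ IsIntegral X'' ∧ IsDominant ((τ ≫ σ') ≫ q) ∧
      IsPullback j₂ t₂ ((τ ≫ σ') ≫ q) (Spec.map (CommRingCat.ofHom θ)) ∧ j₂ ≫ τ = υ ≫ j ∧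
      j₂ '' closure (υ ⁻¹' (T \ {x})) = closure (τ ⁻¹' (S' \ (s.ker.support : Set X'))) := by
  classical
  set r' : X' ⟶ Spec (.of O) := σ' ≫ q with hr'
  set s₀ := IsLocalRing.closedPoint O with hs₀
  haveI := hproper
  haveI := hdom
  haveI : IsClosedImmersion (Spec.map (CommRingCat.ofHom θ)) := IsClosedImmersion.spec_of_surjective _ hθ
  haveI hjci : IsClosedImmersion j := MorphismProperty.IsStableUnderBaseChange.of_isPullback hsq.flip inferInstance
  have hrangej : Set.range j = r' ⁻¹' {s₀} := by
    rw [range_eq_preimage_of_isPullback hsq, range_specMap_of_surjective_of_field θ hθ]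
  set w₁ : X' := j x with hw₁
  have hr'w₁ : r' w₁ = s₀ := by
    have : w₁ ∈ Set.range j := ⟨x, rfl⟩
    rw [hrangej] at this
    exact this
  have hw₁cl : IsClosed ({w₁} : Set X') := by
    have h := hjci.isClosedEmbedding.isClosedMap _ hxcl
    rwa [Set.image_singleton] at h
  -- (1) good reduction at `w₁`, flatness, a smooth neighbourhood
  have hga : GoodAt r' w₁ := goodAt_of_model O k θ hθ X' F r' hreg j t hsq x hxreg
  have hflat : Flat r' := flat_of_isIntegral_of_isDominant r'
  haveI : LocallyOfFinitePresentation r' := locallyOfFinitePresentation_of_isLocallyNoetherian' r'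
  obtain ⟨U, hw₁U, hU⟩ := exists_smooth_nhd_of_goodAt O X' r' inferInstance hflat w₁ hr'w₁ hga
  -- (2) a `κ`-point at `w₁` and a section through it (Hensel)
  obtain ⟨xpt, hxr, hxrange⟩ := exists_point_of_isClosed O X' r' inferInstance w₁ hw₁cl hr'w₁
  obtain ⟨s, hs, hsx⟩ := exists_section_of_smooth O X' r' U hU xpt
    (by rw [hxrange]; exact Set.singleton_subset_iff.mpr hw₁U) hxr
  have hss₀ : s s₀ = w₁ := by
    haveI : IsLocalHom (CommRingCat.ofHom (IsLocalRing.residue O)).hom :=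
      inferInstanceAs (IsLocalHom (IsLocalRing.residue O))
    have h1 : Spec.map (CommRingCat.ofHom (IsLocalRing.residue O))
        (IsLocalRing.closedPoint (IsLocalRing.ResidueField O)) = s₀ := AlgebraicGeometry.Spec_closedPoint
    have h2 : s s₀ = xpt (IsLocalRing.closedPoint (IsLocalRing.ResidueField O)) := by
      rw [← h1, ← Scheme.Hom.comp_apply, hsx]
    rw [h2]
    exact (Set.ext_iff.mp hxrange _).mp (Set.mem_range_self _)
  have hsU : s s₀ ∈ U := hss₀ ▸ hw₁U
  have hrs : ∀ p : Spec (.of O), r' (s p) = p := fun p => by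
    rw [← Scheme.Hom.comp_apply, hs]; rfl
  -- (3) the centre `C = ker s`: regular, flat, special fibre the reduced point `x`
  haveI : IsSeparated r' := inferInstance
  obtain ⟨_, hCreg, -, hCsupp⟩ := section_isClosedImmersion_and_isRegular_ker O X' r' s hs
  have hCflat : Flat (s.ker.subschemeι ≫ σ' ≫ q) := flat_kerSubschemeι_comp_of_section O r' s hs
  have hrange' : Set.range (j ≫ r') ⊆ {s₀} := by
    rintro _ ⟨y, rfl⟩
    have : j y ∈ Set.range j := ⟨y, rfl⟩
    rw [hrangej] at this
    exact this
  have hCD : s.ker.comap j = vanishingIdeal ⟨{x}, hxcl⟩ :=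
    ker_section_comap_eq_vanishingIdeal O X' F r' s hs j hrange' x hss₀.symm hxcl
  -- (4) off the generic point of `Y`
  have hoff : σ' '' (s.ker.support : Set X') ⊆ {y : P | ¬ IsGenericPoint y Y} := by
    rintro _ ⟨c, hc, rfl⟩ hgen
    rw [hCsupp] at hc
    obtain ⟨p, rfl⟩ := hc
    have hps : p = s₀ := by
      rw [← hrs p]
      show (σ' ≫ q) (s p) = s₀
      rw [Scheme.Hom.comp_apply]
      exact hY hgen.mem
    rw [hps, hss₀] at hgen
    exact hw hgen
  have hDT : ((vanishingIdeal ⟨{x}, hxcl⟩ : F.IdealSheafData).support : Set F) ⊆ T := by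
    rw [coe_support_vanishingIdeal]
    exact Set.singleton_subset_iff.mpr hxT
  -- (5) the centre is a proper ideal sheaf: `T` has a point other than `x`
  have hCne : s.ker ≠ ⊥ := by
    intro h
    apply hTx
    intro y hy
    have hyC : j y ∈ (s.ker.support : Set X') := by rw [h, Scheme.IdealSheafData.support_bot]; trivial
    rw [hCsupp] at hyC
    obtain ⟨p, hp⟩ := hyC
    have hps : p = s₀ := by
      rw [← hrs p, hp]
      exact hrange' ⟨y, rfl⟩
    rw [hps, hss₀] at hp
    exact hjci.isClosedEmbedding.injective hp.symm
  -- (6) blow up and run the model step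
  obtain ⟨X'', τ, hτ⟩ := exists_isBlowup X' s.ker
  obtain ⟨hCh'', hreg'', hnoeth'', j₂, t₂, hsq₂, hcomm, hsets⟩ :=
    modelStep O k θ hθ P q Y Ch hStep X' σ' S' hCh hreg F j t hsq T hTS s.ker (vanishingIdeal ⟨{x}, hxcl⟩) hCD hCreg hCflat
      hoff hDT X'' τ hτ F₂ υ hυ
  haveI hint'' : IsIntegral X'' := hτ.isIntegral hCne
  haveI : IsDominant τ := isDominant_of_isBlowup hτ hCne
  have hdom'' : IsDominant ((τ ≫ σ') ≫ q) := by rw [Category.assoc]; infer_instance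
  have hsuppx : ((vanishingIdeal ⟨{x}, hxcl⟩ : F.IdealSheafData).support : Set F) = {x} := by
    rw [coe_support_vanishingIdeal]; rfl
  rw [hsuppx] at hsets
  exact ⟨U, s, X'', τ, j₂, t₂, hU, hs, hss₀, hsU, hτ, hCh'', hreg'', hnoeth'', hint'', hdom'', hsq₂, hcomm, hsets⟩

end Summit.ResolutionOfSingularities.ResolutionOfSingularities.Cruxes.EquisingularLiftNat.Sections

end
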